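import Summits.Ventures.QEC.Census.CertBZPlaneLanes
import HarnessLib

/-!
# Lane-parallel replay of a Brouwer–Zimmermann matrix — soundness II: the colex triangle and segments COVER
# every selection (theorems only)

`TriOK m tri` (defined in `Census/CertBZPlane.lean`): every level `w` of the triangle of the prefix `[0,m)` is bounded
(`Bnd`), has `m` indicator words, and COVERS every strictly increasing `w`-list below `m` (some lane selects exactly
it). `triOK_init` / `triOK_step` (Pascal step: the old lanes stay in the low part, the `(w−1)`-lists with `m` appended
form the high part, the new row word is `ones <<< N_w`) / `triOK_triAt`; then `covers_catLevels`, `covers_blockOf`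
(row `m` added to every lane), `segAcc_spec` and `covers_segment`: the segment `[m₀, m₀+s)` covers `J' ++ [m]` for
every `m` in it and every strictly increasing `J'` below `m` of length `≤ t − 1` — i.e. every selection of size
`1 … t` by its largest row. Axioms standard.
-/

namespace Summit.Ventures.QEC.Census.Plane

open List

/-! ## The colex triangle covers every subset of its prefix -/

/-- The empty family is bounded. -/
theorem bnd_empty : Bnd (0, []) := fun j => by simp

/-- `getD` of a `replicate` with the replicated value as default. -/
theorem getD_replicate_self {α : Type*} (L : ℕ) (x : α) (i : ℕ) : (List.replicate L x).getD i x = x := by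
  rw [List.getD_eq_getElem?_getD, List.getElem?_replicate]
  split <;> rfl

/-- Levels of the `m ↦ m+1` step: level `w` becomes `(N_w + N_{w−1}, mergeChis N_w N_{w−1} χ^w χ^{w−1})`, the
level below the first one being `(Np, chisp)`. -/
theorem getD_triStepAux : ∀ (levels : List (ℕ × List ℕ)) (Np : ℕ) (chisp : List ℕ) (w : ℕ), w < levels.length →
    (triStepAux Np chisp levels).getD w (0, []) =
      ((levels.getD w (0, [])).1 + (if w = 0 then (Np, chisp) else levels.getD (w - 1) (0, [])).1,
        mergeChis (levels.getD w (0, [])).1 (if w = 0 then (Np, chisp) else levels.getD (w - 1) (0, [])).1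
          (levels.getD w (0, [])).2 (if w = 0 then (Np, chisp) else levels.getD (w - 1) (0, [])).2)
  | [], _, _, w, hw => absurd hw (Nat.not_lt_zero _)
  | (N, chis) :: rest, Np, chisp, 0, _ => by simp [triStepAux]
  | (N, chis) :: rest, Np, chisp, w + 1, hw => by
    rw [triStepAux, List.getD_cons_succ, getD_triStepAux rest N chis w (by simpa using hw)]
    cases w <;> simp

/-- The step keeps the number of levels. -/
theorem length_triStepAux : ∀ (levels : List (ℕ × List ℕ)) (Np : ℕ) (chisp : List ℕ),
    (triStepAux Np chisp levels).length = levels.length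
  | [], _, _ => rfl
  | (N, chis) :: rest, Np, chisp => by rw [triStepAux, List.length_cons, length_triStepAux rest]; rfl

/-- Number of levels of `triStep`. -/
theorem length_triStep (tri : List (ℕ × List ℕ)) : (triStep tri).length = tri.length := length_triStepAux tri 0 []

/-- Number of levels of `triAt`. -/
theorem length_triAt (L : ℕ) : ∀ m, (triAt m L).length = L + 1
  | 0 => by simp [triAt, triInit]
  | m + 1 => by rw [triAt, length_triStep, length_triAt L m]

/-- Entries of `mergeChis` (lists of length `m` resp. `≤ m`). -/
theorem getD_mergeChis (N Np : ℕ) (X P : List ℕ) (m : ℕ) (hX : X.length = m) (hP : P.length ≤ m) (j : ℕ) :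
    (mergeChis N Np X P).getD j 0 =
      if j < m then (zipLorShift N X P).getD j 0 else if j = m then (ones Np) <<< N else 0 := by
  have hlen : (zipLorShift N X P).length = m := by rw [length_zipLorShift, hX]; omega
  rw [mergeChis, getD_append_single, hlen]
  rfl

/-- A strictly increasing list below `m + 1` containing `m` ends in `m`. -/
theorem eq_concat_of_mem_of_pairwise {J : List ℕ} (hJ : J.Pairwise (· < ·)) {m : ℕ} (hlt : ∀ j ∈ J, j < m + 1)
    (hm : m ∈ J) : ∃ J' : List ℕ, J = J' ++ [m] ∧ (∀ j ∈ J', j < m) ∧ J'.Pairwise (· < ·) := by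
  rcases List.eq_nil_or_concat J with h | ⟨J', a, h⟩
  · subst h; simp at hm
  · subst h
    simp only [List.concat_eq_append] at hJ hlt hm ⊢
    rw [List.pairwise_append] at hJ
    have ha : a = m := by
      rcases List.mem_append.1 hm with h' | h'
      · have := hJ.2.2 m h' a (List.mem_singleton_self a)
        have := hlt a (List.mem_append_right _ (List.mem_singleton_self a))
        omega
      · exact (by simpa using h' : m = a).symm
    subst ha
    exact ⟨J', rfl, fun j hj => hJ.2.2 j hj a (List.mem_singleton_self a), hJ.1⟩

/-- The initial triangle satisfies the invariant at `m = 0`. -/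
theorem triOK_init (L : ℕ) : TriOK 0 (triInit L) := by
  intro w hw
  rcases w with _ | w
  · simp only [triInit, List.getD_cons_zero]
    refine ⟨fun j => by simp, rfl, fun J _ _ hJl => ⟨0, Nat.one_pos, fun j => ?_⟩⟩
    rw [List.length_eq_zero_iff] at hJl
    subst hJl
    simp
  · simp only [triInit, List.getD_cons_succ, getD_replicate_self]
    refine ⟨fun j => by simp, rfl, fun J _ hJm hJl => ?_⟩
    exfalso
    obtain ⟨x, hx⟩ := List.exists_mem_of_length_pos (by omega : 0 < J.length)
    exact Nat.not_lt_zero _ (hJm x hx)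

/-- **The step preserves the invariant** (`m ↦ m+1`): old lanes stay (low part), the `(w−1)`-subsets with `m`
added are appended (high part), the new row word is `ones <<< N_w`. -/
theorem triOK_step {m : ℕ} {tri : List (ℕ × List ℕ)} (h : TriOK m tri) : TriOK (m + 1) (triStep tri) := by
  intro w hw
  rw [length_triStep] at hw
  rw [triStep, getD_triStepAux tri 0 [] w hw]
  -- the level and the level below
  obtain ⟨hBL, hlenL, hcovL⟩ := h w hw
  set L := tri.getD w (0, []) with hLdef
  set P : ℕ × List ℕ := (if w = 0 then ((0 : ℕ), ([] : List ℕ)) else tri.getD (w - 1) (0, [])) with hPdef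
  have hBP : Bnd P := by
    rw [hPdef]; split
    · exact bnd_empty
    · exact (h (w - 1) (by omega)).1
  have hlenP : P.2.length ≤ m := by
    rw [hPdef]; split
    · simp
    · exact ((h (w - 1) (by omega)).2.1).le
  have hcovP : w ≠ 0 → ∀ J : List ℕ, J.Pairwise (· < ·) → (∀ j ∈ J, j < m) → J.length = w - 1 → Covers P J := by
    intro hw0 J hJ hJm hJl
    rw [hPdef, if_neg hw0]
    exact (h (w - 1) (by omega)).2.2 J hJ hJm hJl
  have hget : ∀ j, (mergeChis L.1 P.1 L.2 P.2).getD j 0 =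
      if j < m then (zipLorShift L.1 L.2 P.2).getD j 0 else if j = m then (ones P.1) <<< L.1 else 0 :=
    getD_mergeChis L.1 P.1 L.2 P.2 m hlenL hlenP
  refine ⟨?_, ?_, ?_⟩
  · -- bounded by 2^(N_w + N_{w-1})
    intro j
    simp only
    rw [hget]
    split
    · exact zipLorShift_lt L.1 P.1 L.2 P.2 hBL hBP j
    · split
      · rw [Nat.shiftLeft_eq, Nat.pow_add, Nat.mul_comm (2 ^ L.1)]
        exact Nat.mul_lt_mul_of_lt_of_le (ones_lt P.1) le_rfl (Nat.two_pow_pos _)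
      · exact Nat.two_pow_pos _
  · -- m + 1 words
    simp only
    rw [mergeChis, List.length_append, length_zipLorShift, hlenL, List.length_singleton]
    omega
  · -- coverage
    intro J hJ hJm hJl
    by_cases hmJ : m ∈ J
    · -- `m ∈ J`: a high lane of the level below
      obtain ⟨J', rfl, hJ'm, hJ'p⟩ := eq_concat_of_mem_of_pairwise hJ hJm hmJ
      have hw0 : w ≠ 0 := by rw [List.length_append, List.length_singleton] at hJl; omega
      have hJ'l : J'.length = w - 1 := by rw [List.length_append, List.length_singleton] at hJl; omega
      obtain ⟨b', hb', hbits⟩ := hcovP hw0 J' hJ'p hJ'm hJ'l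
      refine ⟨L.1 + b', by simp only at hb' ⊢; omega, fun j => ?_⟩
      simp only
      rw [hget]
      split
      · rw [testBit_zipLorShift_hi L.1 L.2 P.2 hBL j b', hbits j]
        have : j ≠ m := by omega
        simp [List.mem_append, this]
      · split
        · subst_vars
          rw [Nat.testBit_shiftLeft, testBit_ones]
          simp [hb']
        · rw [Nat.zero_testBit]
          have h1 : j ∉ J' := fun hj => by have := hJ'm j hj; omega
          have h2 : j ≠ m := by assumption
          simp [List.mem_append, h1, h2]
    · -- `m ∉ J`: an old lane of the same level
      have hJm' : ∀ j ∈ J, j < m := fun j hj => by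
        have := hJm j hj
        have : j ≠ m := fun e => hmJ (e ▸ hj)
        omega
      obtain ⟨b, hb, hbits⟩ := hcovL J hJ hJm' hJl
      refine ⟨b, by simp only at hb ⊢; omega, fun j => ?_⟩
      simp only
      rw [hget]
      split
      · rw [testBit_zipLorShift_lo L.1 L.2 P.2 j hb, hbits j]
      · split
        · subst_vars
          rw [Nat.testBit_shiftLeft]
          have : ¬ (b ≥ L.1) := by omega
          simp [this, hmJ]
        · rw [Nat.zero_testBit]
          have : j ∉ J := fun hj => by have := hJm j hj; omega
          simp [this]

/-- `triAt m L` satisfies the invariant at `m` (with `L + 1` levels). -/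
theorem triOK_triAt (L : ℕ) : ∀ m, TriOK m (triAt m L)
  | 0 => triOK_init L
  | m + 1 => triOK_step (triOK_triAt L m)

/-! ## Blocks and segments cover every selection by its largest row -/

/-- `catLevels` is bounded. -/
theorem bnd_catLevels : ∀ (tri : List (ℕ × List ℕ)), (∀ w, w < tri.length → Bnd (tri.getD w (0, []))) →
    Bnd (catLevels tri)
  | [], _ => bnd_empty
  | (N, X) :: rest, h => by
    rw [catLevels]
    exact bnd_concat (h 0 (by simp)) (bnd_catLevels rest fun w hw => by simpa using h (w + 1) (by simpa using hw))

/-- `catLevels` keeps every level's lanes. -/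
theorem covers_catLevels : ∀ (tri : List (ℕ × List ℕ)), (∀ w, w < tri.length → Bnd (tri.getD w (0, []))) →
    ∀ w, w < tri.length → ∀ J : List ℕ, Covers (tri.getD w (0, [])) J → Covers (catLevels tri) J
  | [], _, w, hw, _, _ => absurd hw (Nat.not_lt_zero _)
  | (N, X) :: rest, h, 0, _, J, hJ => by
    rw [catLevels]
    exact covers_concat_left _ _ (by simpa using hJ)
  | (N, X) :: rest, h, w + 1, hw, J, hJ => by
    rw [catLevels]
    refine covers_concat_right N X (h 0 (by simp)) ?_
    exact covers_catLevels rest (fun w hw => by simpa using h (w + 1) (by simpa using hw)) w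
      (by simpa using hw) J (by simpa using hJ)

/-- `catLevels` of levels with `m` words has `m` words (non-empty level list). -/
theorem length_catLevels (m : ℕ) : ∀ (tri : List (ℕ × List ℕ)),
    (∀ w, w < tri.length → (tri.getD w (0, [])).2.length = m) → tri ≠ [] → (catLevels tri).2.length = m
  | [], _, h => absurd rfl h
  | (N, X) :: rest, h, _ => by
    rw [catLevels]
    simp only
    rw [length_zipLorShift, show X.length = m by simpa using h 0 (by simp)]
    by_cases hr : rest = []
    · subst hr; simp [catLevels]
    · rw [length_catLevels m rest (fun w hw => by simpa using h (w + 1) (by simpa using hw)) hr, max_self]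

/-- `blockOf` is bounded. -/
theorem bnd_blockOf (tri : List (ℕ × List ℕ)) (h : Bnd (catLevels tri)) : Bnd (blockOf tri) := by
  intro j
  simp only [blockOf]
  rw [getD_append_single]
  split
  · exact h j
  · split
    · exact ones_lt _
    · exact Nat.two_pow_pos _

/-- **The block of `m` covers `J' ++ [m]`** whenever some level covers `J'` (`J'` below `m`). -/
theorem covers_blockOf (tri : List (ℕ × List ℕ)) {m : ℕ} (hB : ∀ w, w < tri.length → Bnd (tri.getD w (0, [])))
    (hlen : (catLevels tri).2.length = m) {w : ℕ} (hw : w < tri.length) {J' : List ℕ}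
    (hcov : Covers (tri.getD w (0, [])) J') (hJ' : ∀ j ∈ J', j < m) : Covers (blockOf tri) (J' ++ [m]) := by
  obtain ⟨b, hb, hbits⟩ := covers_catLevels tri hB w hw J' hcov
  refine ⟨b, hb, fun j => ?_⟩
  simp only [blockOf]
  rw [getD_append_single, hlen]
  split
  · rw [hbits j]
    have : j ≠ m := by omega
    simp [List.mem_append, this]
  · split
    · subst_vars
      rw [testBit_ones]
      simp [hb]
    · rw [Nat.zero_testBit]
      have h1 : j ∉ J' := fun hj => by have := hJ' j hj; omega
      have h2 : j ≠ m := by assumption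
      simp [List.mem_append, h1, h2]

/-- `triStep (triAt m L) = triAt (m+1) L`. -/
theorem triStep_triAt (m L : ℕ) : triStep (triAt m L) = triAt (m + 1) L := rfl

/-- **Segment accumulation**: bounded, keeps the lanes of `acc`, and covers `J' ++ [m']` for every `m'` in
`[m, m+s)` and every strictly increasing `J'` below `m'` of length `≤ L`. -/
theorem segAcc_spec (L : ℕ) : ∀ (s m : ℕ) (acc : ℕ × List ℕ), Bnd acc →
    Bnd (segAcc m s (triAt m L) acc) ∧
    (∀ J, Covers acc J → Covers (segAcc m s (triAt m L) acc) J) ∧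
    (∀ m', m ≤ m' → m' < m + s → ∀ J' : List ℕ, J'.Pairwise (· < ·) → (∀ j ∈ J', j < m') →
      J'.length ≤ L → Covers (segAcc m s (triAt m L) acc) (J' ++ [m']))
  | 0, m, acc, hacc => ⟨hacc, fun _ h => h, fun m' h1 h2 => by omega⟩
  | s + 1, m, acc, hacc => by
    have hT := triOK_triAt L m
    have hlenT := length_triAt L m
    have hBT : ∀ w, w < (triAt m L).length → Bnd ((triAt m L).getD w (0, [])) := fun w hw => (hT w hw).1
    have hBblk : Bnd (blockOf (triAt m L)) := bnd_blockOf _ (bnd_catLevels _ hBT)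
    have hacc' : Bnd (acc.1 + (blockOf (triAt m L)).1, zipLorShift acc.1 acc.2 (blockOf (triAt m L)).2) :=
      bnd_concat hacc hBblk
    obtain ⟨hB, hkeep, hcov⟩ := segAcc_spec L s (m + 1) _ hacc'
    rw [segAcc, triStep_triAt]
    refine ⟨hB, fun J hJ => hkeep J (covers_concat_left _ _ hJ), fun m' h1 h2 J' hJ'p hJ'm hJ'l => ?_⟩
    by_cases hm : m' = m
    · subst hm
      apply hkeep
      apply covers_concat_right _ _ hacc
      have hlencat : (catLevels (triAt m' L)).2.length = m' :=
        length_catLevels m' _ (fun w hw => (hT w hw).2.1) (by rw [← List.length_pos_iff_ne_nil, hlenT]; omega)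
      exact covers_blockOf _ hBT hlencat (w := J'.length) (by rw [hlenT]; omega)
        ((hT J'.length (by rw [hlenT]; omega)).2.2 J' hJ'p hJ'm rfl) hJ'm
    · exact hcov m' (by omega) (by omega) J' hJ'p hJ'm hJ'l

/-- **The segment family covers every selection of size `1 … t` whose largest row lies in the segment.** -/
theorem covers_segment (t m0 s : ℕ) {m : ℕ} (hm0 : m0 ≤ m) (hm : m < m0 + s) (J' : List ℕ)
    (hJ' : J'.Pairwise (· < ·)) (hlt : ∀ j ∈ J', j < m) (hlen : J'.length ≤ t - 1) :
    Covers (segment t m0 s) (J' ++ [m]) :=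
  (segAcc_spec (t - 1) s m0 (0, []) bnd_empty).2.2 m hm0 hm J' hJ' hlt hlen

end Summit.Ventures.QEC.Census.Plane
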